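import Literature.Analysis.FluidPDE.BackwardUniquenessCoreFirst
import Literature.Analysis.FluidPDE.BackwardUniquenessRescale
import Literature.Analysis.FluidPDE.BackwardUniquenessWeights
import Literature.Analysis.FluidPDE.BackwardHeatRegularityProofs
import HarnessLib

/-!
# Backward uniqueness in a half-space, the decay lemma (Seregin 2014, Lemma A.2)

Analysis/FluidPDE proof file (theorems only) in the backward-uniqueness track of **ns.S08**
(`ess_backward_uniqueness`, ESS 2003 Thm. 5.1 = Seregin 2014, Thm. A.3.5). We prove
**Lemma A.2** of Seregin 2014, App. A.3 (p. 212, (A.3.5)–(A.3.15)) for the `C²` functions of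
the vendored statement: there are absolute constants `A₀ > 0`, `β > 0` and, for every `c₁`,
constants `γ = γ(c₁, E) ∈ ]0, 1/12]`, `c₂ = c₂(c₁, E, F)` such that every `u : ]0,1[ × ℝⁿ₊ → F`
of class `C²`, continuous up to `t = 0` with `u(0, ·) = 0`, with `∂ₜu` square integrable on
bounded subsets (the part of (A.3.4) that is used), satisfying `|∂ₜu + Δu| ≤ c₁(|u| + |∇u|)`
((A.3.1)) and `|u(t, x)| ≤ e^{A|x|²}` with `0 ≤ A ≤ A₀` ((A.3.5)), obeys
`|u(t, x)| ≤ c₂ e^{4A|x'|²} e^{-β xₙ²/t}` for `xₙ = ⟪x, e⟫ > 2`, `0 < t < γ` ((A.3.6);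
`|x'|² = |x|² - xₙ²`).

Proof (Seregin's, pp. 212–213): the gradient bound (A.3.7) (`halfspace_gradient_growth`, from
the interior estimate `Carleman.exists_sqrt_gradSq_le_of_backwardHeat`); the parabolic scaling
`v(s, y) = u(λ²s - t/2, x + λy)`, `λ = √(3t)`, `ρ = (xₙ - 1)/λ` ((A.3.8)–(A.3.10), via
`BackwardUniquenessRescale`); the first Carleman inequality with cut-offs (`Carleman.core_first`,
(A.3.11)) with `a = κρ²` and the weight estimates of `BackwardUniquenessWeights` ((A.3.12)–(A.3.14));
the initial layer, where the source extends `u` by zero to `t < 0`, is instead cut off on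
`[1/6 + θ, 1/6 + 2θ]` and the error is `o(1)` as `θ → 0` by `Carleman.exists_layer_integral_le`;
finally the `L∞–L²` estimate (A.3.15) (`Carleman.norm_sq_le_integral_of_backwardHeat`).

All statements are proved; no definitions.

## References

* G. Seregin, *Lecture notes on regularity theory for the Navier–Stokes equations*, World
  Scientific 2014, App. A.3, Lemma A.2, (A.3.5)–(A.3.15), pp. 212–213. [Seregin2014]
* L. Escauriaza, G. Seregin, V. Šverák, Russ. Math. Surveys 58:2 (2003) 211–250, §5, (5.6)–(5.8).
-/

noncomputable section

open MeasureTheory Set Function Filter Metric Real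
open _root_.Topology
open scoped InnerProductSpace RealInnerProductSpace ENNReal

namespace Literature.Analysis.FluidPDE

namespace Carleman

section Decay

variable (E : Type*) [NormedAddCommGroup E] [InnerProductSpace ℝ E] [FiniteDimensional ℝ E]
  [MeasurableSpace E] [BorelSpace E]
variable (F : Type*) [NormedAddCommGroup F] [InnerProductSpace ℝ F] [CompleteSpace F]

/-! ### The gradient bound (A.3.7) -/

omit [MeasurableSpace E] [BorelSpace E] [CompleteSpace F] in
/-- **Seregin 2014, (A.3.7)** (for `C²` functions, any finite-dimensional `E`): there is
`C = C(E) > 0` such that for `c₁, A ≥ 0`, a unit vector `e`, and `u ∈ C²(]0,1[ × {⟪x,e⟫ > 0})`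
with `|∂ₜu + Δu| ≤ c₁(|u| + |∇u|)` and `|u(t, x)| ≤ e^{A|x|²}` there,
`|u| + |∇u| ≤ (1 + 2C(1 + c₁)e^{A/2}) e^{2A|x|²}` on `]0, 1/2[ × {⟪x, e⟫ > 1}` (the interior
gradient estimate on the future cylinders `[t, t + 1/4] × B̄(x, 1/2)`; cf.
`seregin_backwardHeat_halfspace_gradient_growth_holds` for `ℝⁿ`). [cite: Seregin2014, App. A.3 (A.3.7)] -/
theorem halfspace_gradient_growth : ∃ C : ℝ, 0 < C ∧ ∀ (c₁ A : ℝ), 0 ≤ c₁ → 0 ≤ A →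
    ∀ (e : E), ‖e‖ = 1 → ∀ (u : ℝ × E → F),
      ContDiffOn ℝ 2 u (Ioo (0 : ℝ) 1 ×ˢ {x : E | 0 < ⟪x, e⟫}) →
      (∀ z ∈ Ioo (0 : ℝ) 1 ×ˢ {x : E | 0 < ⟪x, e⟫},
        ‖dt u z + lap u z‖ ≤ c₁ * (‖u z‖ + Real.sqrt (gradSq u z))) →
      (∀ z ∈ Ioo (0 : ℝ) 1 ×ˢ {x : E | 0 < ⟪x, e⟫}, ‖u z‖ ≤ Real.exp (A * ‖z.2‖ ^ 2)) →
      ∀ z ∈ Ioo (0 : ℝ) (1 / 2) ×ˢ {x : E | 1 < ⟪x, e⟫},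
        ‖u z‖ + Real.sqrt (gradSq u z) ≤
          (1 + 2 * C * (1 + c₁) * Real.exp (A / 2)) * Real.exp (2 * A * ‖z.2‖ ^ 2) := by
  obtain ⟨C, hC, hmain⟩ := exists_sqrt_gradSq_le_of_backwardHeat E F
  refine ⟨C, hC, ?_⟩
  intro c₁ A hc₁ hA e he u hu hineq hgrowth z hz
  obtain ⟨t, x⟩ := z
  obtain ⟨⟨ht0, ht1⟩, hx⟩ := hz
  replace hx : 1 < ⟪x, e⟫ := hx
  set U : Set (ℝ × E) := Ioo (0 : ℝ) 1 ×ˢ {x : E | 0 < ⟪x, e⟫} with hU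
  have hUo : IsOpen U :=
    isOpen_Ioo.prod (isOpen_lt continuous_const (continuous_id.inner continuous_const))
  have hinner : ∀ y : E, ‖y - x‖ ≤ 1 / 2 → 0 < ⟪y, e⟫ := by
    intro y hy
    have h1 : |⟪y - x, e⟫| ≤ ‖y - x‖ * ‖e‖ := abs_real_inner_le_norm _ _
    rw [he, mul_one, inner_sub_left] at h1
    have h2 := neg_abs_le (⟪y, e⟫ - ⟪x, e⟫)
    linarith
  have hsub : Icc (t - t / 2) (t + (1 / 2) ^ 2) ×ˢ closedBall x (1 / 2) ⊆ U := by
    rintro ⟨s, y⟩ ⟨⟨hs0, hs1⟩, hy⟩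
    rw [mem_closedBall, dist_eq_norm] at hy
    exact ⟨⟨by linarith, by nlinarith⟩, hinner y hy⟩
  have hcylU : Icc t (t + (1 / 2) ^ 2) ×ˢ closedBall x (1 / 2) ⊆ U := fun z hz =>
    hsub ⟨⟨by linarith [hz.1.1], hz.1.2⟩, hz.2⟩
  set M : ℝ := Real.exp (A / 2) * Real.exp (2 * A * ‖x‖ ^ 2) with hM
  have hM0 : 0 ≤ M := by positivity
  have hMb : ∀ z ∈ Icc t (t + (1 / 2) ^ 2) ×ˢ closedBall x (1 / 2), ‖u z‖ ≤ M := by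
    rintro ⟨s, y⟩ hz
    have hy : ‖y - x‖ ≤ 1 / 2 := by
      have := hz.2
      rwa [mem_closedBall, dist_eq_norm] at this
    refine (hgrowth _ (hcylU hz)).trans ?_
    rw [hM, ← Real.exp_add]
    refine Real.exp_le_exp.2 ?_
    have h1 : ‖y‖ ≤ ‖x‖ + 1 / 2 := by
      have := norm_le_norm_add_norm_sub' y x
      linarith
    have h2 : ‖y‖ ^ 2 ≤ 2 * ‖x‖ ^ 2 + 1 / 2 := by
      have h3 : ‖y‖ ^ 2 ≤ (‖x‖ + 1 / 2) ^ 2 := pow_le_pow_left₀ (norm_nonneg _) h1 2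
      nlinarith [sq_nonneg (‖x‖ - 1 / 2)]
    show A * ‖y‖ ^ 2 ≤ A / 2 + 2 * A * ‖x‖ ^ 2
    have h4 := mul_le_mul_of_nonneg_left h2 hA
    linarith
  have hineq' : ∀ z ∈ Icc t (t + (1 / 2) ^ 2) ×ˢ closedBall x (1 / 2),
      ‖dt u z + lap u z‖ ≤ c₁ * (‖u z‖ + Real.sqrt (gradSq u z)) := fun z hz => hineq z (hcylU hz)
  have hgrad := hmain hUo (by norm_num : (0 : ℝ) < 1 / 2) (by norm_num) (by linarith : 0 < t / 2)
    hc₁ hM0 hsub hu hineq' hMb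
  have hu_le : ‖u (t, x)‖ ≤ Real.exp (2 * A * ‖x‖ ^ 2) := by
    have hzU : ((t, x) : ℝ × E) ∈ U := ⟨⟨ht0, by linarith⟩, by
      show 0 < ⟪x, e⟫
      linarith⟩
    refine (hgrowth _ hzU).trans (Real.exp_le_exp.2 ?_)
    show A * ‖x‖ ^ 2 ≤ 2 * A * ‖x‖ ^ 2
    nlinarith [sq_nonneg ‖x‖]
  calc ‖u (t, x)‖ + Real.sqrt (gradSq u (t, x))
      ≤ Real.exp (2 * A * ‖x‖ ^ 2) + C * (1 + c₁) * M / (1 / 2) := add_le_add hu_le hgrad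
    _ = (1 + 2 * C * (1 + c₁) * Real.exp (A / 2)) * Real.exp (2 * A * ‖x‖ ^ 2) := by
        rw [hM]; ring

/-! ### Lemma A.2: the error term on the cut-off regions -/

omit [CompleteSpace F] in
/-- **The error term (A.3.12)–(A.3.13).** Let `ρ ≥ 2`, `0 < s₁`, `a = κρ²` with `0 < κ ≤ 1/256`,
and let `v ∈ C²(O)`, `O ⊇ [s₁, 7/4] × B̄(0, ρ - 1/2)` open, satisfy `|v| + |∇v| ≤ M e^{q|y|²}` on `O`
with `0 ≤ q ≤ 1/32`. Then, with `W = h^{-2a}(s)e^{-|y|²/4s}` and `ω` the union of the top layer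
and the annulus of `Carleman.core_first`,
`∫_ω W(|v|² + |∇v|²) ≤ M² ∫_ω h^{-2a}(s) e^{-|y|²/8s}` (`(A.3.12)`: `e^{q|y|²}e^{-|y|²/4s} ≤ e^{-|y|²/8s}`). [cite: Seregin2014, App. A.3 (A.3.12)–(A.3.13)] -/
theorem decay_errRegion {v : ℝ × E → F} {O : Set (ℝ × E)} {ρ s₁ M q κ : ℝ} (hO : IsOpen O)
    (hKO : Icc s₁ (7 / 4) ×ˢ closedBall (0 : E) (ρ - 1 / 2) ⊆ O) (hv : ContDiffOn ℝ 2 v O)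
    (hs₁ : 0 < s₁) (hs₁' : s₁ ≤ 3 / 2) (hq : 0 ≤ q) (hq32 : q ≤ 1 / 32) (hM : 0 ≤ M)
    (hbd : ∀ z ∈ O, ‖v z‖ + Real.sqrt (gradSq v z) ≤ M * Real.exp (q * ‖z.2‖ ^ 2)) :
    ∫ z in (Icc (3 / 2 : ℝ) (7 / 4) ×ˢ closedBall (0 : E) (ρ - 1 / 2)) ∪
        (Icc s₁ (7 / 4) ×ˢ (closedBall (0 : E) (ρ - 1 / 2) \ ball 0 (ρ - 1))),
        carlemanWeight (κ * ρ ^ 2) z * (‖v z‖ ^ 2 + gradSq v z) ≤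
      M ^ 2 * ∫ z in (Icc (3 / 2 : ℝ) (7 / 4) ×ˢ closedBall (0 : E) (ρ - 1 / 2)) ∪
        (Icc s₁ (7 / 4) ×ˢ (closedBall (0 : E) (ρ - 1 / 2) \ ball 0 (ρ - 1))),
        hW z.1 ^ (-(2 * (κ * ρ ^ 2))) * Real.exp (-‖z.2‖ ^ 2 / (8 * z.1)) := by
  set a : ℝ := κ * ρ ^ 2 with ha
  set Kc : Set (ℝ × E) := Icc s₁ (7 / 4) ×ˢ closedBall (0 : E) (ρ - 1 / 2) with hKc
  set Stop : Set (ℝ × E) := Icc (3 / 2 : ℝ) (7 / 4) ×ˢ closedBall (0 : E) (ρ - 1 / 2) with hStop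
  set Sann : Set (ℝ × E) := Icc s₁ (7 / 4) ×ˢ (closedBall (0 : E) (ρ - 1 / 2) \ ball 0 (ρ - 1))
    with hSann
  have hKcc : IsCompact Kc := isCompact_Icc.prod (isCompact_closedBall _ _)
  have htopK : Stop ⊆ Kc := Set.prod_mono (Icc_subset_Icc_left (by linarith)) Subset.rfl
  have hannK : Sann ⊆ Kc := Set.prod_mono Subset.rfl Set.sdiff_subset
  have hunK : Stop ∪ Sann ⊆ Kc := union_subset htopK hannK
  have hunm : MeasurableSet (Stop ∪ Sann) :=
    (measurableSet_Icc.prod measurableSet_closedBall).union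
      (measurableSet_Icc.prod (measurableSet_closedBall.diff measurableSet_ball))
  have hKpos : ∀ z ∈ Kc, 0 < z.1 := fun z hz => lt_of_lt_of_le hs₁ hz.1.1
  have hWKc : ContinuousOn (carlemanWeight a : ℝ × E → ℝ) Kc :=
    (continuousOn_carlemanWeight a hs₁).mono fun z hz => by
      show s₁ / 2 < z.1
      linarith [hz.1.1]
  have cvO : ContinuousOn v O := hv.continuousOn
  have cgvO : ContinuousOn (gradSq v) O := by
    have hf : ContinuousOn (fderiv ℝ v) O := hv.continuousOn_fderiv_of_isOpen hO (by norm_num)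
    show ContinuousOn (fun z => gradSq v z) O
    simp only [gradSq, dx]
    exact continuousOn_finsetSum _ fun i _ => ((hf.clm_apply continuousOn_const).norm.pow 2)
  set g : ℝ × E → ℝ := fun z => hW z.1 ^ (-(2 * a)) * Real.exp (-‖z.2‖ ^ 2 / (8 * z.1)) with hg
  have hgc : ContinuousOn g Kc := by
    refine ContinuousOn.mul ?_ ?_
    · refine ContinuousOn.rpow_const ?_ fun z hz => Or.inl (hW_pos (hKpos z hz)).ne'
      exact (continuous_fst.mul ((continuous_const.sub continuous_fst).div_const _).rexp).continuousOn
    · refine (ContinuousOn.div ?_ ?_ fun z hz => mul_ne_zero (by norm_num) (hKpos z hz).ne').rexp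
      · exact (continuous_snd.norm.pow 2).neg.continuousOn
      · exact (continuous_const.mul continuous_fst).continuousOn
  have hi1 : IntegrableOn (fun z => carlemanWeight a z * (‖v z‖ ^ 2 + gradSq v z)) (Stop ∪ Sann) :=
    ((hWKc.mul (((cvO.mono hKO).norm.pow 2).add (cgvO.mono hKO))).integrableOn_compact
      hKcc).mono_set hunK
  have hi2 : IntegrableOn (fun z => M ^ 2 * g z) (Stop ∪ Sann) :=
    ((hgc.integrableOn_compact hKcc).mono_set hunK).const_mul _
  have hptw : ∀ z ∈ Stop ∪ Sann, carlemanWeight a z * (‖v z‖ ^ 2 + gradSq v z) ≤ M ^ 2 * g z := by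
    intro z hz
    have hzK := hunK hz
    have hzO := hKO hzK
    have hz0 : 0 < z.1 := hKpos z hzK
    have hz2 : z.1 ≤ 2 := by linarith [hzK.1.2]
    have hb := hbd z hzO
    have hP0 : 0 ≤ M * Real.exp (q * ‖z.2‖ ^ 2) := by positivity
    have hsq : ‖v z‖ ^ 2 + gradSq v z ≤ (M * Real.exp (q * ‖z.2‖ ^ 2)) ^ 2 := by
      have hg0 := gradSq_nonneg v z
      have hs := Real.sq_sqrt hg0
      have hvn := norm_nonneg (v z)
      have hsn := Real.sqrt_nonneg (gradSq v z)
      have h2 := pow_le_pow_left₀ (by positivity) hb 2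
      nlinarith
    have hP2 : (M * Real.exp (q * ‖z.2‖ ^ 2)) ^ 2 = M ^ 2 * Real.exp (2 * q * ‖z.2‖ ^ 2) := by
      rw [mul_pow, ← Real.exp_nat_mul]; ring_nf
    have hW0z : 0 ≤ carlemanWeight a z := (carlemanWeight_pos a hz0).le
    have hmul := carlemanWeight_mul_exp_le a (q := 2 * q) (by positivity) (by linarith) hz0 hz2
    calc carlemanWeight a z * (‖v z‖ ^ 2 + gradSq v z)
        ≤ carlemanWeight a z * (M * Real.exp (q * ‖z.2‖ ^ 2)) ^ 2 :=
          mul_le_mul_of_nonneg_left hsq hW0z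
      _ = M ^ 2 * (carlemanWeight a z * Real.exp (2 * q * ‖z.2‖ ^ 2)) := by rw [hP2]; ring
      _ ≤ M ^ 2 * g z := mul_le_mul_of_nonneg_left hmul (sq_nonneg _)
  calc ∫ z in Stop ∪ Sann, carlemanWeight a z * (‖v z‖ ^ 2 + gradSq v z)
      ≤ ∫ z in Stop ∪ Sann, M ^ 2 * g z := setIntegral_mono_on hi1 hi2 hunm hptw
    _ = M ^ 2 * ∫ z in Stop ∪ Sann, g z := integral_const_mul _ _

/-! ### Lemma A.2: the lower bound of the weight on the inner cylinder -/

omit [InnerProductSpace ℝ F] [CompleteSpace F] in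
/-- **(A.3.14), lower bound**: on `]1/2, 1[ × B(0, 1)` the weight is at least `e^{-1/2}`, so
`∫ |v|² ≤ e^{1/2} ∫ W|v|²` there (`a ≥ 0`; `v` continuous near the closed cylinder). [cite: Seregin2014, App. A.3 (A.3.14)] -/
theorem decay_lower {v : ℝ × E → F} {O : Set (ℝ × E)} {a : ℝ} (ha : 0 ≤ a)
    (hKO : Icc (1 / 2 : ℝ) 1 ×ˢ closedBall (0 : E) 1 ⊆ O) (hv : ContinuousOn v O) :
    ∫ z in Ioo (1 / 2 : ℝ) 1 ×ˢ ball (0 : E) 1, ‖v z‖ ^ 2 ≤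
      Real.exp (1 / 2) * ∫ z in Ioo (1 / 2 : ℝ) 1 ×ˢ ball (0 : E) 1,
        carlemanWeight a z * ‖v z‖ ^ 2 := by
  set KG : Set (ℝ × E) := Icc (1 / 2 : ℝ) 1 ×ˢ closedBall (0 : E) 1 with hKG
  set G : Set (ℝ × E) := Ioo (1 / 2 : ℝ) 1 ×ˢ ball (0 : E) 1 with hGdef
  have hGm : MeasurableSet G := measurableSet_Ioo.prod measurableSet_ball
  have hKGc : IsCompact KG := isCompact_Icc.prod (isCompact_closedBall _ _)
  have hGKG : G ⊆ KG := Set.prod_mono Ioo_subset_Icc_self ball_subset_closedBall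
  have hWKG : ContinuousOn (carlemanWeight a : ℝ × E → ℝ) KG :=
    (continuousOn_carlemanWeight a (by norm_num : (0 : ℝ) < 1 / 2)).mono fun z hz => by
      show 1 / 2 / 2 < z.1
      linarith [hz.1.1]
  have hi1 : IntegrableOn (fun z => ‖v z‖ ^ 2) G :=
    (((hv.mono hKO).norm.pow 2).integrableOn_compact hKGc).mono_set hGKG
  have hi2 : IntegrableOn (fun z => carlemanWeight a z * ‖v z‖ ^ 2) G :=
    ((hWKG.mul ((hv.mono hKO).norm.pow 2)).integrableOn_compact hKGc).mono_set hGKG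
  rw [← integral_const_mul]
  refine setIntegral_mono_on hi1 (hi2.const_mul _) hGm fun z hz => ?_
  have hz1 : 1 / 2 ≤ z.1 := hz.1.1.le
  have hz2 : z.1 ≤ 1 := hz.1.2.le
  have hy : ‖z.2‖ < 1 := by have := hz.2; rwa [mem_ball, dist_zero_right] at this
  have hW1 : Real.exp (-(1 / 2)) ≤ carlemanWeight a z := by
    refine le_trans (Real.exp_le_exp.2 ?_) (exp_neg_le_carlemanWeight ha hz1 hz2)
    have : ‖z.2‖ ^ 2 ≤ 1 := by nlinarith [norm_nonneg z.2]
    linarith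
  have he : Real.exp (1 / 2) * Real.exp (-(1 / 2)) = 1 := by
    rw [← Real.exp_add]; norm_num
  calc ‖v z‖ ^ 2 = Real.exp (1 / 2) * Real.exp (-(1 / 2)) * ‖v z‖ ^ 2 := by rw [he, one_mul]
    _ ≤ Real.exp (1 / 2) * carlemanWeight a z * ‖v z‖ ^ 2 := by gcongr
    _ = Real.exp (1 / 2) * (carlemanWeight a z * ‖v z‖ ^ 2) := by ring

/-! ### Lemma A.2: the Carleman step in the rescaled variables -/

set_option maxHeartbeats 800000 in
/-- **Lemma A.2, the Carleman step** (Seregin 2014, (A.3.11)–(A.3.14)) in the rescaled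
variables `v(s, y) = u(λ²s - t/2, x + λy)` on `O = ]1/6, 2[ × B(0, ρ)`: if `v ∈ C²(O)`
satisfies `|∂ₛv + Δv| ≤ c(|v| + |∇v|)` with `c² ≤ κ_cf` (the absorption threshold of
`Carleman.core_first`, passed in as the hypothesis `hcore`), `|v| + |∇v| ≤ M e^{q|y|²}` with
`q ≤ 1/32` ((A.3.9)), `ρ ≥ 2` and `a = ρ²/256 ≥ 2`, and if `v` is continuous down to the
initial slice `s = 1/6` where it vanishes on `B̄(0, ρ - 1/2)`, with `∂ₛv` square integrable on
`]1/6, 2[ × B̄(0, ρ - 1/2)`, then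
`∫_{]1/2,1[×B(0,1)} |v|² ≤ e^{1/2} C_cf M² C_w h(3/2)^{-2a}`
(`C_w` the constant of `Carleman.weight_integral_le`, passed in as `hweight`). The initial layer
is cut off on `[1/6 + θ, 1/6 + 2θ]` and `θ → 0` (`Carleman.exists_layer_integral_le`), instead of
the source's extension by zero to `t < 0`. [cite: Seregin2014, App. A.3 (A.3.11)–(A.3.14)] -/
theorem decay_step {κcf Ccf Cw : ℝ} (hCcf : 0 < Ccf)
    (hcore : ∀ (c a s₁ s₂ ρ : ℝ) (v : ℝ × E → F) (O : Set (ℝ × E)),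
      IsOpen O → Icc s₁ (7 / 4) ×ˢ closedBall (0 : E) (ρ - 1 / 2) ⊆ O → ContDiffOn ℝ 2 v O →
      (∀ z ∈ O, ‖dt v z + lap v z‖ ≤ c * (‖v z‖ + Real.sqrt (gradSq v z))) →
      c ^ 2 ≤ κcf → 0 < s₁ → s₁ < s₂ → s₂ ≤ 1 / 2 → 2 ≤ ρ → 2 ≤ a →
      ∀ G ⊆ Icc s₂ (3 / 2) ×ˢ closedBall (0 : E) (ρ - 1), MeasurableSet G →
      ∫ z in G, carlemanWeight a z * ‖v z‖ ^ 2 ≤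
        Ccf * ((s₂ - s₁)⁻¹ ^ 2 *
            (∫ z in Icc s₁ s₂ ×ˢ closedBall (0 : E) (ρ - 1 / 2), carlemanWeight a z * ‖v z‖ ^ 2) +
          ∫ z in (Icc (3 / 2) (7 / 4) ×ˢ closedBall (0 : E) (ρ - 1 / 2)) ∪
              (Icc s₁ (7 / 4) ×ˢ (closedBall (0 : E) (ρ - 1 / 2) \ ball 0 (ρ - 1))),
            carlemanWeight a z * (‖v z‖ ^ 2 + gradSq v z)))
    (hweight : ∀ (ρ s₁ κ : ℝ), 2 ≤ ρ → 0 < s₁ → 0 < κ → κ ≤ 1 / 256 →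
      ∫ z in (Icc (3 / 2 : ℝ) (7 / 4) ×ˢ closedBall (0 : E) (ρ - 1 / 2)) ∪
          (Icc s₁ (7 / 4) ×ˢ (closedBall (0 : E) (ρ - 1 / 2) \ ball 0 (ρ - 1))),
        hW z.1 ^ (-(2 * (κ * ρ ^ 2))) * Real.exp (-‖z.2‖ ^ 2 / (8 * z.1)) ≤
      Cw * hW (3 / 2) ^ (-(2 * (κ * ρ ^ 2))))
    {v : ℝ × E → F} {ρ c M q : ℝ} (hρ : 2 ≤ ρ) (ha2 : 2 ≤ 1 / 256 * ρ ^ 2)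
    (hv : ContDiffOn ℝ 2 v (Ioo (1 / 6 : ℝ) 2 ×ˢ ball (0 : E) ρ))
    (hBH : ∀ z ∈ Ioo (1 / 6 : ℝ) 2 ×ˢ ball (0 : E) ρ,
      ‖dt v z + lap v z‖ ≤ c * (‖v z‖ + Real.sqrt (gradSq v z)))
    (hc : c ^ 2 ≤ κcf) (hq : 0 ≤ q) (hq16 : q ≤ 1 / 32) (hM : 0 ≤ M)
    (hbd : ∀ z ∈ Ioo (1 / 6 : ℝ) 2 ×ˢ ball (0 : E) ρ,
      ‖v z‖ + Real.sqrt (gradSq v z) ≤ M * Real.exp (q * ‖z.2‖ ^ 2))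
    (hvcont : ContinuousOn v (Ico (1 / 6 : ℝ) (1 / 6 + 11 / 6) ×ˢ closedBall (0 : E) (ρ - 1 / 2)))
    (hv0 : ∀ y ∈ closedBall (0 : E) (ρ - 1 / 2), v (1 / 6, y) = 0)
    (hfin : ∫⁻ z in Ioo (1 / 6 : ℝ) (1 / 6 + 11 / 6) ×ˢ closedBall (0 : E) (ρ - 1 / 2),
      ‖dt v z‖ₑ ^ 2 < ∞) :
    ∫ z in Ioo (1 / 2 : ℝ) 1 ×ˢ ball (0 : E) 1, ‖v z‖ ^ 2 ≤
      Real.exp (1 / 2) * (Ccf * (M ^ 2 * (Cw * hW (3 / 2) ^ (-(2 * (1 / 256 * ρ ^ 2)))))) := by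
  set κ : ℝ := 1 / 256 with hκ
  set a : ℝ := κ * ρ ^ 2 with ha
  have ha0 : 0 ≤ a := by positivity
  set O : Set (ℝ × E) := Ioo (1 / 6 : ℝ) 2 ×ˢ ball (0 : E) ρ with hO
  have hOo : IsOpen O := isOpen_Ioo.prod isOpen_ball
  set B : Set E := closedBall (0 : E) (ρ - 1 / 2) with hBdef
  have hBm : MeasurableSet B := measurableSet_closedBall
  have hBvol : volume B ≠ ∞ := measure_closedBall_lt_top.ne
  have hBρ : B ⊆ ball (0 : E) ρ := closedBall_subset_ball (by linarith)
  have hsubO : Ioo (1 / 6 : ℝ) (1 / 6 + 11 / 6) ×ˢ B ⊆ O := by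
    rw [show (1 / 6 : ℝ) + 11 / 6 = 2 by norm_num]
    exact Set.prod_mono Subset.rfl hBρ
  have hvC1 : ContDiffOn ℝ 1 v O := hv.of_le (by norm_num)
  set G : Set (ℝ × E) := Ioo (1 / 2 : ℝ) 1 ×ˢ ball (0 : E) 1 with hGdef
  have hGm : MeasurableSet G := measurableSet_Ioo.prod measurableSet_ball
  set W : ℝ × E → ℝ := carlemanWeight a with hWdef
  set M16 : ℝ := hW (1 / 6) ^ (-(2 * a)) with hM16
  have hM160 : 0 < M16 := Real.rpow_pos_of_pos (hW_pos (by norm_num)) _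
  set Rω : ℝ := M ^ 2 * (Cw * hW (3 / 2) ^ (-(2 * a))) with hRω
  have cvO : ContinuousOn v O := hv.continuousOn
  -- ### the Carleman estimate on `G`, up to an arbitrary `ε > 0`
  have hIG : ∫ z in G, W z * ‖v z‖ ^ 2 ≤ Ccf * Rω := by
    refine le_of_forall_pos_le_add fun ε hε => ?_
    set ε' : ℝ := ε / (9 * Ccf * M16 + 1) with hε'
    have hε'0 : 0 < ε' := by positivity
    obtain ⟨θ₀, hθ₀, hlayer⟩ := exists_layer_integral_le hOo hvC1 hsubO hvcont hv0 hBm hBvol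
      (by norm_num : (0 : ℝ) < 11 / 6) hfin hε'0
    set θ : ℝ := min (θ₀ / 3) (1 / 6) with hθ
    have hθ0 : 0 < θ := lt_min (by linarith [hθ₀.1]) (by norm_num)
    have hθ3 : 3 * θ ≤ θ₀ := by linarith [min_le_left (θ₀ / 3) (1 / 6)]
    have hθ6 : θ ≤ 1 / 6 := min_le_right _ _
    set s₁ : ℝ := 1 / 6 + θ with hs₁
    set s₂ : ℝ := 1 / 6 + 2 * θ with hs₂
    have hs₁0 : 0 < s₁ := by positivity
    have hs₁₂ : s₁ < s₂ := by rw [hs₁, hs₂]; linarith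
    have hs₂h : s₂ ≤ 1 / 2 := by rw [hs₂]; linarith
    have hs21 : s₂ - s₁ = θ := by rw [hs₁, hs₂]; ring
    set Kc : Set (ℝ × E) := Icc s₁ (7 / 4) ×ˢ closedBall (0 : E) (ρ - 1 / 2) with hKc
    have hKcO : Kc ⊆ O :=
      Set.prod_mono (fun s hs => ⟨by linarith [hs.1, hs₁0, hθ0], by linarith [hs.2]⟩) hBρ
    have hKcc : IsCompact Kc := isCompact_Icc.prod (isCompact_closedBall _ _)
    have hGsub : G ⊆ Icc s₂ (3 / 2) ×ˢ closedBall (0 : E) (ρ - 1) := by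
      intro z hz
      refine ⟨⟨by linarith [hz.1.1], by linarith [hz.1.2]⟩, ?_⟩
      have := hz.2
      rw [mem_ball, dist_zero_right] at this
      rw [mem_closedBall, dist_zero_right]
      linarith
    -- `core_first`
    have hcf := hcore c a s₁ s₂ ρ v O hOo hKcO hv hBH hc hs₁0 hs₁₂ hs₂h hρ ha2 G hGsub hGm
    rw [hs21] at hcf
    -- the error term on the cut-off regions
    have hUω : ∫ z in (Icc (3 / 2) (7 / 4) ×ˢ closedBall (0 : E) (ρ - 1 / 2)) ∪
        (Icc s₁ (7 / 4) ×ˢ (closedBall (0 : E) (ρ - 1 / 2) \ ball 0 (ρ - 1))),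
        carlemanWeight a z * (‖v z‖ ^ 2 + gradSq v z) ≤ Rω := by
      have h1 := decay_errRegion (E := E) (F := F) (κ := κ) hOo hKcO hv hs₁0 (by linarith) hq
        hq16 hM hbd
      refine h1.trans ?_
      rw [hRω]
      exact mul_le_mul_of_nonneg_left (hweight ρ s₁ κ hρ hs₁0 (by norm_num) le_rfl) (sq_nonneg _)
    -- the initial layer
    have hTbot : θ⁻¹ ^ 2 * ∫ z in Icc s₁ s₂ ×ˢ closedBall (0 : E) (ρ - 1 / 2), W z * ‖v z‖ ^ 2 ≤
        9 * M16 * ε' := by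
      set Sbot : Set (ℝ × E) := Icc s₁ s₂ ×ˢ closedBall (0 : E) (ρ - 1 / 2) with hSbot
      set Slay : Set (ℝ × E) := Ioo (1 / 6 : ℝ) (1 / 6 + 3 * θ) ×ˢ B with hSlay
      have hbotm : MeasurableSet Sbot := measurableSet_Icc.prod measurableSet_closedBall
      have hbotK : Sbot ⊆ Kc := Set.prod_mono (Icc_subset_Icc_right (by linarith)) Subset.rfl
      have hbotlay : Sbot ⊆ Slay := Set.prod_mono (fun s hs => ⟨by linarith [hs.1], by
        linarith [hs.2]⟩) Subset.rfl
      have hlayK : IsCompact (Icc (1 / 6 : ℝ) (1 / 6 + 3 * θ) ×ˢ B) :=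
        isCompact_Icc.prod (isCompact_closedBall _ _)
      have hvlay : ContinuousOn v (Icc (1 / 6 : ℝ) (1 / 6 + 3 * θ) ×ˢ B) :=
        hvcont.mono (Set.prod_mono (fun s hs => ⟨hs.1, by linarith [hs.2]⟩) Subset.rfl)
      have hilay : IntegrableOn (fun z => ‖v z‖ ^ 2) Slay :=
        ((hvlay.norm.pow 2).integrableOn_compact hlayK).mono_set
          (Set.prod_mono Ioo_subset_Icc_self Subset.rfl)
      have hWKc : ContinuousOn W Kc := (continuousOn_carlemanWeight a hs₁0).mono fun z hz => by
        show s₁ / 2 < z.1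
        linarith [hz.1.1]
      have hibot : IntegrableOn (fun z => W z * ‖v z‖ ^ 2) Sbot :=
        ((hWKc.mul ((cvO.mono hKcO).norm.pow 2)).integrableOn_compact hKcc).mono_set hbotK
      have h1 : ∫ z in Sbot, W z * ‖v z‖ ^ 2 ≤ ∫ z in Sbot, M16 * ‖v z‖ ^ 2 := by
        refine setIntegral_mono_on hibot ((hilay.mono_set hbotlay).const_mul M16) hbotm
          fun z hz => ?_
        refine mul_le_mul_of_nonneg_right ?_ (sq_nonneg _)
        exact carlemanWeight_le_rpow ha0 (by norm_num : (0 : ℝ) < 1 / 6)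
          (by linarith [hz.1.1] : 1 / 6 ≤ z.1) (by linarith [hz.1.2])
      have h2 : ∫ z in Sbot, M16 * ‖v z‖ ^ 2 ≤ M16 * ∫ z in Slay, ‖v z‖ ^ 2 := by
        rw [integral_const_mul]
        refine mul_le_mul_of_nonneg_left ?_ hM160.le
        exact setIntegral_mono_set hilay (ae_of_all _ fun z => sq_nonneg _)
          (Eventually.of_forall hbotlay)
      have h3 : ∫ z in Slay, ‖v z‖ ^ 2 ≤ ε' * (3 * θ) ^ 2 := hlayer (3 * θ) ⟨by positivity, hθ3⟩
      have hθi : θ⁻¹ ^ 2 * (3 * θ) ^ 2 = 9 := by field_simp; ring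
      calc θ⁻¹ ^ 2 * ∫ z in Sbot, W z * ‖v z‖ ^ 2 ≤ θ⁻¹ ^ 2 * (M16 * (ε' * (3 * θ) ^ 2)) := by
            refine mul_le_mul_of_nonneg_left (h1.trans (h2.trans ?_)) (by positivity)
            exact mul_le_mul_of_nonneg_left h3 hM160.le
        _ = 9 * M16 * ε' := by rw [← hθi]; ring
    -- conclusion
    have hfinal : Ccf * (9 * M16 * ε') ≤ ε := by
      rw [hε', show Ccf * (9 * M16 * (ε / (9 * Ccf * M16 + 1))) =
        ε * (9 * Ccf * M16 / (9 * Ccf * M16 + 1)) by ring]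
      have : 9 * Ccf * M16 / (9 * Ccf * M16 + 1) ≤ 1 := by
        rw [div_le_one (by positivity)]; linarith
      nlinarith
    calc ∫ z in G, W z * ‖v z‖ ^ 2
        ≤ Ccf * (θ⁻¹ ^ 2 * (∫ z in Icc s₁ s₂ ×ˢ closedBall (0 : E) (ρ - 1 / 2), W z * ‖v z‖ ^ 2) +
            ∫ z in (Icc (3 / 2) (7 / 4) ×ˢ closedBall (0 : E) (ρ - 1 / 2)) ∪
              (Icc s₁ (7 / 4) ×ˢ (closedBall (0 : E) (ρ - 1 / 2) \ ball 0 (ρ - 1))),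
              W z * (‖v z‖ ^ 2 + gradSq v z)) := hcf
      _ ≤ Ccf * (9 * M16 * ε' + Rω) := by gcongr
      _ = Ccf * Rω + Ccf * (9 * M16 * ε') := by ring
      _ ≤ Ccf * Rω + ε := by linarith [hfinal]
  -- ### the lower bound of the weight on `G`
  have hKO' : Icc (1 / 2 : ℝ) 1 ×ˢ closedBall (0 : E) 1 ⊆ O :=
    Set.prod_mono (fun s hs => ⟨by linarith [hs.1], by linarith [hs.2]⟩)
      (closedBall_subset_ball (by linarith))
  have hlow := decay_lower (E := E) (F := F) ha0 hKO' cvO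
  calc ∫ z in G, ‖v z‖ ^ 2 ≤ Real.exp (1 / 2) * ∫ z in G, W z * ‖v z‖ ^ 2 := hlow
    _ ≤ Real.exp (1 / 2) * (Ccf * Rω) := mul_le_mul_of_nonneg_left hIG (Real.exp_pos _).le

/-! ### Lemma A.2: the bound (A.3.9) for the rescaled function -/

omit [MeasurableSpace E] [BorelSpace E] [CompleteSpace F] in
/-- **(A.3.9)**: if `|u| + |∇u| ≤ C₀ e^{2A|w|²}` on `S` and `Φ = stAffine λ² λ t₀ x` maps `O`
into `S` (`0 < λ ≤ 1`, `4Aλ² ≤ 1/64`), then `v = u ∘ Φ` satisfies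
`|v| + |∇v| ≤ C₀ e^{4A|x|²} e^{|y|²/64}` on `O` (`|x + λy|² ≤ 2|x|² + 2λ²|y|²`,
`|∇v| = λ|∇u| ∘ Φ ≤ |∇u| ∘ Φ`). [cite: Seregin2014, App. A.3 (A.3.9)] -/
theorem decay_vbound {u : ℝ × E → F} {x : E} {l t₀ A C₀ : ℝ} {S O : Set (ℝ × E)}
    (hl0 : 0 < l) (hl1 : l ≤ 1) (hA : 0 ≤ A) (hC₀ : 0 ≤ C₀) (hq : 4 * A * l ^ 2 ≤ 1 / 64)
    (hbd : ∀ w ∈ S, ‖u w‖ + Real.sqrt (gradSq u w) ≤ C₀ * Real.exp (2 * A * ‖w.2‖ ^ 2))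
    (hOS : O ⊆ stAffine (l ^ 2) l t₀ x ⁻¹' S) :
    ∀ z ∈ O, ‖u (stAffine (l ^ 2) l t₀ x z)‖ +
        Real.sqrt (gradSq (fun z => u (stAffine (l ^ 2) l t₀ x z)) z) ≤
      (C₀ * Real.exp (4 * A * ‖x‖ ^ 2)) * Real.exp (1 / 64 * ‖z.2‖ ^ 2) := by
  intro z hz
  have h1 := hbd _ (hOS hz)
  have hgv : Real.sqrt (gradSq (fun z => u (stAffine (l ^ 2) l t₀ x z)) z) ≤
      Real.sqrt (gradSq u (stAffine (l ^ 2) l t₀ x z)) := by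
    rw [gradSq_comp_stAffine (by positivity) hl0.ne', Real.sqrt_mul (sq_nonneg _),
      Real.sqrt_sq hl0.le]
    exact mul_le_of_le_one_left (Real.sqrt_nonneg _) hl1
  have hΦ2 : (stAffine (l ^ 2) l t₀ x z).2 = x + l • z.2 := by simp
  have h2 : ‖(stAffine (l ^ 2) l t₀ x z).2‖ ^ 2 ≤ 2 * ‖x‖ ^ 2 + 2 * l ^ 2 * ‖z.2‖ ^ 2 := by
    rw [hΦ2]
    have h3 := norm_add_le x (l • z.2)
    rw [norm_smul, Real.norm_eq_abs, abs_of_pos hl0] at h3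
    have h4 : 0 ≤ ‖x + l • z.2‖ := norm_nonneg _
    have h5 : ‖x + l • z.2‖ ^ 2 ≤ (‖x‖ + l * ‖z.2‖) ^ 2 := pow_le_pow_left₀ h4 h3 2
    have h6 : (‖x‖ + l * ‖z.2‖) ^ 2 ≤ 2 * ‖x‖ ^ 2 + 2 * l ^ 2 * ‖z.2‖ ^ 2 := by
      have := sq_nonneg (‖x‖ - l * ‖z.2‖)
      nlinarith
    exact h5.trans h6
  have h3 : 2 * A * ‖(stAffine (l ^ 2) l t₀ x z).2‖ ^ 2 ≤ 4 * A * ‖x‖ ^ 2 + 1 / 64 * ‖z.2‖ ^ 2 := by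
    have h4 := mul_le_mul_of_nonneg_left h2 (by positivity : 0 ≤ 2 * A)
    have h5 := mul_le_mul_of_nonneg_right hq (sq_nonneg ‖z.2‖)
    have h6 : 2 * A * (2 * ‖x‖ ^ 2 + 2 * l ^ 2 * ‖z.2‖ ^ 2) =
        4 * A * ‖x‖ ^ 2 + 4 * A * l ^ 2 * ‖z.2‖ ^ 2 := by ring
    linarith
  calc ‖u (stAffine (l ^ 2) l t₀ x z)‖ + Real.sqrt (gradSq (fun z => u (stAffine (l ^ 2) l t₀ x z)) z)
      ≤ ‖u (stAffine (l ^ 2) l t₀ x z)‖ + Real.sqrt (gradSq u (stAffine (l ^ 2) l t₀ x z)) :=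
        add_le_add le_rfl hgv
    _ ≤ C₀ * Real.exp (2 * A * ‖(stAffine (l ^ 2) l t₀ x z).2‖ ^ 2) := h1
    _ ≤ C₀ * Real.exp (4 * A * ‖x‖ ^ 2 + 1 / 64 * ‖z.2‖ ^ 2) :=
        mul_le_mul_of_nonneg_left (Real.exp_le_exp.2 h3) hC₀
    _ = (C₀ * Real.exp (4 * A * ‖x‖ ^ 2)) * Real.exp (1 / 64 * ‖z.2‖ ^ 2) := by
        rw [Real.exp_add]; ring

/-! ### Lemma A.2 -/

set_option maxHeartbeats 800000 in
/-- **Seregin 2014, Lemma A.2 (decay in a half-space)**, for `C²` functions on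
`Q₊ = ]0, 1[ × {⟪x, e⟫ > 0}` (`e` a unit vector of the finite-dimensional inner product space `E`;
the source: `ℝⁿ`, `e = eₙ`). There are absolute constants `A₀ > 0`, `β > 0`, and for every
`c₁ ≥ 0` constants `γ ∈ ]0, 1/12]`, `c₂ > 0` (depending on `c₁`, `E`, `F`) such that: if `u` is
`C²` on `Q₊`, continuous on `[0, 1[ × {⟪x, e⟫ > 0}` with `u(0, ·) = 0` ((A.3.2)), `∂ₜu` is
square integrable on bounded measurable subsets of `Q₊` ((A.3.4)), `|∂ₜu + Δu| ≤ c₁(|u| + |∇u|)`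
on `Q₊` ((A.3.1)) and `|u(t, x)| ≤ e^{A|x|²}` on `Q₊` with `0 ≤ A ≤ A₀` ((A.3.5)), then
`|u(t, x)| ≤ c₂ e^{4A(|x|² - ⟪x,e⟫²)} e^{-β⟪x,e⟫²/t}` for all `0 < t < γ` and `⟪x, e⟫ > 2`
((A.3.6): `|u(x,t)| ≤ c₂ e^{4A|x'|²} e^{-βxₙ²/t}` on `(ℝⁿ₊ + 2eₙ) × ]0, γ[`; the source has
`β = 8A` for `0 < A ≤ A₀`, here `β` is absolute, which for `A ≤ A₀` is the same statement up
to the values of the constants). [cite: Seregin2014, App. A.3 Lemma A.2 (A.3.6)] -/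
theorem decay_halfspace : ∃ A₀ β : ℝ, 0 < A₀ ∧ 0 < β ∧ ∀ c₁ : ℝ, 0 ≤ c₁ →
    ∃ γ c₂ : ℝ, 0 < γ ∧ γ ≤ 1 / 12 ∧ 0 < c₂ ∧
    ∀ (e : E), ‖e‖ = 1 → ∀ (u : ℝ × E → F) (A : ℝ), 0 ≤ A → A ≤ A₀ →
      ContDiffOn ℝ 2 u (Ioo (0 : ℝ) 1 ×ˢ {x : E | 0 < ⟪x, e⟫}) →
      ContinuousOn u (Ico (0 : ℝ) 1 ×ˢ {x : E | 0 < ⟪x, e⟫}) →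
      (∀ x : E, 0 < ⟪x, e⟫ → u (0, x) = 0) →
      (∀ z ∈ Ioo (0 : ℝ) 1 ×ˢ {x : E | 0 < ⟪x, e⟫},
        ‖dt u z + lap u z‖ ≤ c₁ * (‖u z‖ + Real.sqrt (gradSq u z))) →
      (∀ z ∈ Ioo (0 : ℝ) 1 ×ˢ {x : E | 0 < ⟪x, e⟫}, ‖u z‖ ≤ Real.exp (A * ‖z.2‖ ^ 2)) →
      (∀ K ⊆ Ioo (0 : ℝ) 1 ×ˢ {x : E | 0 < ⟪x, e⟫}, Bornology.IsBounded K → MeasurableSet K →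
        ∫⁻ z in K, ‖dt u z‖ₑ ^ 2 < ∞) →
      ∀ t ∈ Ioo (0 : ℝ) γ, ∀ x : E, 2 < ⟪x, e⟫ →
        ‖u (t, x)‖ ≤ c₂ * Real.exp (4 * A * (‖x‖ ^ 2 - ⟪x, e⟫ ^ 2)) *
          Real.exp (-(β * ⟪x, e⟫ ^ 2 / t)) := by
  -- ### the constants
  obtain ⟨κcf, Ccf, hκcf, hCcf, hcore⟩ := core_first (E := E) (F := F)
  obtain ⟨Cw, hCw, hweight⟩ := weight_integral_le E
  obtain ⟨Cg, hCg, hgg⟩ := halfspace_gradient_growth E F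
  obtain ⟨κ, hκ⟩ : ∃ κ : ℝ, κ = 1 / 256 := ⟨_, rfl⟩
  obtain ⟨L, hL⟩ : ∃ L : ℝ, L = Real.log (hW (3 / 2)) := ⟨_, rfl⟩
  have hκ0 : 0 < κ := by rw [hκ]; norm_num
  have hL0 : 0 < L := by rw [hL]; exact log_hW_three_halves_pos
  have hL2 : L ≤ 1 / 2 := by rw [hL]; exact log_hW_three_halves_le
  obtain ⟨A₀, hA₀⟩ : ∃ A₀ : ℝ, A₀ = κ * L / 96 := ⟨_, rfl⟩
  have hA₀0 : 0 < A₀ := by rw [hA₀]; positivity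
  have hA₀1 : A₀ ≤ 1 := by rw [hA₀, hκ]; linarith only [hL2, hL0]
  refine ⟨A₀, κ * L / 24, hA₀0, by positivity, fun c₁ hc₁ => ?_⟩
  obtain ⟨c₉, hc₉, h315⟩ := norm_sq_le_integral_of_backwardHeat (E := E) (F := F) c₁
  set c₃ : ℝ := 1 + 2 * Cg * (1 + c₁) * Real.exp (A₀ / 2) with hc₃
  have hc₃0 : 0 < c₃ := by positivity
  set γ : ℝ := min (1 / 1536) (κcf / (3 * c₁ ^ 2 + 1)) with hγ
  have hγ0 : 0 < γ := lt_min (by norm_num) (by positivity)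
  have hγ1 : γ ≤ 1 / 1536 := min_le_left _ _
  have hγ2 : γ ≤ κcf / (3 * c₁ ^ 2 + 1) := min_le_right _ _
  set Cfin : ℝ := c₉ * (Real.exp (1 / 2) * (Ccf * ((c₃ * Real.exp (8 * A₀)) ^ 2 * Cw))) with hCfin
  have hCfin0 : 0 < Cfin := by positivity
  refine ⟨γ, Real.sqrt Cfin + 1, hγ0, hγ1.trans (by norm_num), by positivity, ?_⟩
  intro e he u A hA hAA₀ hu hcont h0 hBH hgrowth hint t ht x hx
  -- ### the half-space cylinder
  set H : Set E := {x : E | 0 < ⟪x, e⟫} with hH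
  set Q : Set (ℝ × E) := Ioo (0 : ℝ) 1 ×ˢ H with hQ
  obtain ⟨ht0, htγ⟩ := ht
  have ht1 : t ≤ 1 / 1536 := htγ.le.trans hγ1
  have hxn2 : 2 < ⟪x, e⟫ := hx
  -- ### the scale `λ = √(3t)` and the radius `ρ = (xₙ - 1)/λ`
  set l : ℝ := Real.sqrt (3 * t) with hl
  have hl0 : 0 < l := Real.sqrt_pos.2 (by positivity)
  have hl2 : l ^ 2 = 3 * t := Real.sq_sqrt (by positivity)
  have hl1 : l ≤ 1 / 2 := by
    rw [hl, show (1 / 2 : ℝ) = Real.sqrt (1 / 4) by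
      rw [show (1 / 4 : ℝ) = (1 / 2) ^ 2 by norm_num, Real.sqrt_sq (by norm_num)]]
    exact Real.sqrt_le_sqrt (by linarith)
  have hl1' : l ≤ 1 := hl1.trans (by norm_num)
  set ρ : ℝ := (⟪x, e⟫ - 1) / l with hρ
  have hρl : l * ρ = ⟪x, e⟫ - 1 := by rw [hρ]; field_simp
  have hρ2 : 2 ≤ ρ := by rw [hρ, le_div_iff₀ hl0]; nlinarith only [hl1, hxn2]
  have hρ0 : 0 < ρ := by linarith
  have hρsq : 1 ≤ 3 * t * ρ ^ 2 := by
    have h1 : (l * ρ) ^ 2 = l ^ 2 * ρ ^ 2 := by ring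
    have h2 : 1 ≤ l * ρ := by rw [hρl]; linarith only [hxn2]
    have h3 : 1 ≤ (l * ρ) ^ 2 := by nlinarith only [h2]
    rw [h1, hl2] at h3
    linarith only [h3]
  have ha2 : 2 ≤ 1 / 256 * ρ ^ 2 := by
    have h512 : (512 : ℝ) ≤ ρ ^ 2 := by
      by_contra hcon
      push Not at hcon
      have : 3 * t * ρ ^ 2 < 3 * (1 / 1536) * 512 := by nlinarith only [hcon, ht0, ht1, sq_nonneg ρ]
      linarith only [this, hρsq]
    linarith only [h512]
  -- ### the rescaled function `v = u ∘ Φ`, `Φ(s, y) = (λ²s - t/2, x + λy)`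
  set Φ : ℝ × E → ℝ × E := stAffine (l ^ 2) l (-(t / 2)) x with hΦdef
  set v : ℝ × E → F := fun z => u (Φ z) with hv
  have hΦ1 : ∀ z : ℝ × E, (Φ z).1 = 3 * t * z.1 - t / 2 := fun z => by
    simp only [hΦdef, stAffine_fst, hl2]; ring
  have hΦ2 : ∀ z : ℝ × E, (Φ z).2 = x + l • z.2 := fun z => by simp [hΦdef]
  have hΦinner : ∀ z : ℝ × E, ‖z.2‖ < ρ → 1 < ⟪(Φ z).2, e⟫ := by
    intro z hz
    rw [hΦ2, inner_add_left, inner_smul_left, RCLike.conj_to_real]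
    have h1 : |⟪z.2, e⟫| ≤ ‖z.2‖ := by
      have := abs_real_inner_le_norm z.2 e; rwa [he, mul_one] at this
    have h2 : -‖z.2‖ ≤ ⟪z.2, e⟫ := by linarith [neg_abs_le ⟪z.2, e⟫]
    have h3 : l * ‖z.2‖ < l * ρ := mul_lt_mul_of_pos_left hz hl0
    have h4 := mul_le_mul_of_nonneg_left h2 hl0.le
    have h5 : l * ⟪z.2, e⟫ = ⟪z.2, e⟫ * l := mul_comm _ _
    linarith only [h3, h4, hρl, h5]
  -- the domain `O = ]1/6, 2[ × B(0, ρ)` of `v` and its image in `Q`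
  set O : Set (ℝ × E) := Ioo (1 / 6 : ℝ) 2 ×ˢ ball (0 : E) ρ with hO
  have hOQ' : O ⊆ Φ ⁻¹' (Ioo (0 : ℝ) (1 / 2) ×ˢ {x : E | 1 < ⟪x, e⟫}) := by
    intro z hz
    have hy : ‖z.2‖ < ρ := by have := hz.2; rwa [mem_ball, dist_zero_right] at this
    refine ⟨⟨?_, ?_⟩, hΦinner z hy⟩
    · rw [hΦ1]; nlinarith only [hz.1.1, ht0]
    · rw [hΦ1]; nlinarith only [hz.1.2, ht0, ht1]
  have hOQ : O ⊆ Φ ⁻¹' Q := by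
    intro z hz
    have h := hOQ' hz
    refine ⟨⟨h.1.1, by linarith only [h.1.2]⟩, ?_⟩
    have h2 : 1 < ⟪(Φ z).2, e⟫ := h.2
    show 0 < ⟪(Φ z).2, e⟫
    linarith only [h2]
  -- ### properties of `v` on `O`
  have hvC2 : ContDiffOn ℝ 2 v O := (contDiffOn_comp_stAffine hu (l ^ 2) l (-(t / 2)) x).mono hOQ
  have hvBH : ∀ z ∈ O, ‖dt v z + lap v z‖ ≤ (c₁ * l) * (‖v z‖ + Real.sqrt (gradSq v z)) :=
    fun z hz => backwardHeat_comp_stAffine hc₁ hl0 hl1' hBH z (hOQ hz)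
  have hvBH' : ∀ z ∈ O, ‖dt v z + lap v z‖ ≤ c₁ * (Real.sqrt (gradSq v z) + ‖v z‖) := by
    intro z hz
    rw [add_comm (Real.sqrt (gradSq v z)) (‖v z‖)]
    exact (hvBH z hz).trans (mul_le_mul_of_nonneg_right (mul_le_of_le_one_right hc₁ hl1')
      (by positivity))
  have hsmall : (c₁ * l) ^ 2 ≤ κcf := by
    have h1 : (c₁ * l) ^ 2 = 3 * c₁ ^ 2 * t := by rw [mul_pow, hl2]; ring
    rw [h1]
    have h2 : t ≤ κcf / (3 * c₁ ^ 2 + 1) := htγ.le.trans hγ2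
    rw [le_div_iff₀ (by positivity)] at h2
    have h3 : 0 ≤ c₁ ^ 2 * t := by positivity
    nlinarith only [h2, h3, ht0]
  -- the bound (A.3.9): `|v| + |∇v| ≤ (c₃ e^{4A|x|²}) e^{|y|²/64}` on `O`
  have hgg' := hgg c₁ A hc₁ hA e he u hu hBH hgrowth
  have hC₀0 : 0 ≤ 1 + 2 * Cg * (1 + c₁) * Real.exp (A / 2) := by positivity
  have hc₃A : 1 + 2 * Cg * (1 + c₁) * Real.exp (A / 2) ≤ c₃ := by rw [hc₃]; gcongr
  have hq : 4 * A * l ^ 2 ≤ 1 / 64 := by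
    rw [hl2]
    have h1 : A * t ≤ 1 * (1 / 1536) := mul_le_mul (hAA₀.trans hA₀1) ht1 ht0.le zero_le_one
    linarith only [h1]
  set Mv : ℝ := c₃ * Real.exp (4 * A * ‖x‖ ^ 2) with hMv
  have hMv0 : 0 ≤ Mv := by positivity
  have hvbd0 := decay_vbound (E := E) (F := F) (t₀ := -(t / 2)) hl0 hl1' hA hC₀0 hq hgg' hOQ'
  have hvbd : ∀ z ∈ O, ‖v z‖ + Real.sqrt (gradSq v z) ≤ Mv * Real.exp (1 / 64 * ‖z.2‖ ^ 2) := by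
    intro z hz
    refine (hvbd0 z hz).trans (mul_le_mul_of_nonneg_right ?_ (Real.exp_pos _).le)
    exact mul_le_mul_of_nonneg_right hc₃A (Real.exp_pos _).le
  -- ### the layer data
  set B : Set E := closedBall (0 : E) (ρ - 1 / 2) with hBdef
  have hBm : MeasurableSet B := measurableSet_closedBall
  have hBρ : B ⊆ ball (0 : E) ρ := closedBall_subset_ball (by linarith only [hρ0])
  have hΦO : ∀ z ∈ Ico (1 / 6 : ℝ) 2 ×ˢ B, Φ z ∈ Ico (0 : ℝ) (1 / 2) ×ˢ {x : E | 1 < ⟪x, e⟫} := by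
    intro z hz
    have hy : ‖z.2‖ < ρ := by
      have := hz.2; rw [mem_closedBall, dist_zero_right] at this; linarith only [this]
    refine ⟨⟨?_, ?_⟩, hΦinner z hy⟩
    · rw [hΦ1]; nlinarith only [hz.1.1, ht0]
    · rw [hΦ1]; nlinarith only [hz.1.2, ht0, ht1]
  have hIcoO : Ico (1 / 6 : ℝ) 2 ×ˢ B ⊆ Φ ⁻¹' (Ico (0 : ℝ) 1 ×ˢ H) := by
    intro z hz
    have h := hΦO z hz
    have h2 : 1 < ⟪(Φ z).2, e⟫ := h.2
    refine ⟨⟨h.1.1, by linarith only [h.1.2]⟩, ?_⟩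
    show 0 < ⟪(Φ z).2, e⟫
    linarith only [h2]
  have hvcont : ContinuousOn v (Ico (1 / 6 : ℝ) (1 / 6 + 11 / 6) ×ˢ B) := by
    rw [show (1 / 6 : ℝ) + 11 / 6 = 2 by norm_num]
    exact (continuousOn_comp_stAffine hcont (l ^ 2) l (-(t / 2)) x).mono hIcoO
  have hv0 : ∀ y ∈ B, v (1 / 6, y) = 0 := by
    intro y hy
    have hΦy : Φ ((1 / 6 : ℝ), y) = ((0 : ℝ), x + l • y) := by
      refine Prod.ext ?_ ?_
      · rw [hΦ1]; ring
      · rw [hΦ2]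
    have hyH : 0 < ⟪x + l • y, e⟫ := by
      have h := hΦinner ((1 / 6 : ℝ), y) (by
        have := hBρ hy; rwa [mem_ball, dist_zero_right] at this)
      rw [hΦ2] at h
      exact lt_trans zero_lt_one h
    show u (Φ ((1 / 6 : ℝ), y)) = 0
    rw [hΦy]
    exact h0 _ hyH
  have hsubO : Ioo (1 / 6 : ℝ) (1 / 6 + 11 / 6) ×ˢ B ⊆ O := by
    rw [show (1 / 6 : ℝ) + 11 / 6 = 2 by norm_num]
    exact Set.prod_mono Subset.rfl hBρ
  have hfinv : ∫⁻ z in Ioo (1 / 6 : ℝ) (1 / 6 + 11 / 6) ×ˢ B, ‖dt v z‖ₑ ^ 2 < ∞ := by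
    refine setLIntegral_enorm_dt_comp_stAffine_lt_top (by positivity) hl0 (hint _ ?_ ?_ ?_)
    · intro w hw
      obtain ⟨z, hz, rfl⟩ := hw
      exact hOQ (hsubO hz)
    · exact isBounded_image_stAffine (((Metric.isBounded_Icc (1 / 6 : ℝ) (1 / 6 + 11 / 6)).prod
        Metric.isBounded_closedBall).subset (Set.prod_mono Ioo_subset_Icc_self Subset.rfl))
    · exact measurableSet_image_stAffine (by positivity) hl0.ne' (measurableSet_Ioo.prod hBm)
  -- ### the Carleman step
  have hstep := decay_step (E := E) (F := F) hCcf hcore hweight hρ2 ha2 hvC2 hvBH hsmall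
    (by norm_num : (0 : ℝ) ≤ 1 / 64) (by norm_num : (1 / 64 : ℝ) ≤ 1 / 32) hMv0 hvbd hvcont hv0 hfinv
  -- ### the `L∞–L²` estimate (A.3.15) and the return to `u`
  have hOo : IsOpen O := isOpen_Ioo.prod isOpen_ball
  have hKO' : Icc (1 / 2 : ℝ) 1 ×ˢ closedBall (0 : E) 1 ⊆ O :=
    Set.prod_mono (fun s hs => ⟨by linarith only [hs.1], by linarith only [hs.2]⟩)
      (closedBall_subset_ball (by linarith only [hρ2]))
  have h315' := h315 0 v O hOo hKO' hvC2 hvBH'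
  have hvtx : v ((1 / 2 : ℝ), (0 : E)) = u (t, x) := by
    show u (Φ ((1 / 2 : ℝ), (0 : E))) = u (t, x)
    congr 1
    refine Prod.ext ?_ ?_
    · rw [hΦ1]; ring
    · rw [hΦ2]; simp
  have hMv2 : Mv ^ 2 ≤ (c₃ * Real.exp (8 * A₀)) ^ 2 * Real.exp (8 * A * ‖x‖ ^ 2) := by
    rw [hMv, mul_pow, mul_pow, ← Real.exp_nat_mul, ← Real.exp_nat_mul]
    have h1 : Real.exp ((2 : ℕ) * (4 * A * ‖x‖ ^ 2)) = Real.exp (8 * A * ‖x‖ ^ 2) := by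
      congr 1; push_cast; ring
    rw [h1]
    have h2 : 1 ≤ Real.exp ((2 : ℕ) * (8 * A₀)) := Real.one_le_exp (by positivity)
    have h3 : 0 ≤ c₃ ^ 2 * Real.exp (8 * A * ‖x‖ ^ 2) := by positivity
    have h4 := mul_le_mul_of_nonneg_left h2 h3
    linarith only [h4]
  have hmainsq : ‖u (t, x)‖ ^ 2 ≤
      Cfin * Real.exp (8 * A * ‖x‖ ^ 2) * hW (3 / 2) ^ (-(2 * (1 / 256 * ρ ^ 2))) := by
    rw [← hvtx]
    have hpow0 : 0 ≤ hW (3 / 2) ^ (-(2 * (1 / 256 * ρ ^ 2))) :=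
      Real.rpow_nonneg (lt_trans zero_lt_one one_lt_hW_three_halves).le _
    calc ‖v ((1 / 2 : ℝ), (0 : E))‖ ^ 2
        ≤ c₉ * ∫ z in Ioo (1 / 2 : ℝ) 1 ×ˢ ball (0 : E) 1, ‖v z‖ ^ 2 := h315'
      _ ≤ c₉ * (Real.exp (1 / 2) * (Ccf * (Mv ^ 2 * (Cw * hW (3 / 2) ^ (-(2 * (1 / 256 * ρ ^ 2))))))) :=
          mul_le_mul_of_nonneg_left hstep hc₉.le
      _ ≤ c₉ * (Real.exp (1 / 2) * (Ccf * (((c₃ * Real.exp (8 * A₀)) ^ 2 *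
            Real.exp (8 * A * ‖x‖ ^ 2)) * (Cw * hW (3 / 2) ^ (-(2 * (1 / 256 * ρ ^ 2))))))) := by
          gcongr
      _ = Cfin * Real.exp (8 * A * ‖x‖ ^ 2) * hW (3 / 2) ^ (-(2 * (1 / 256 * ρ ^ 2))) := by
          rw [hCfin]; ring
  -- ### the exponents
  have hh32 : 0 < hW (3 / 2) := lt_trans zero_lt_one one_lt_hW_three_halves
  set xn : ℝ := ⟪x, e⟫ with hxn
  have hρx : xn ^ 2 ≤ 12 * t * ρ ^ 2 := by
    have h1 : xn / 2 ≤ l * ρ := by rw [hρl]; linarith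
    have h2 : (xn / 2) ^ 2 ≤ (l * ρ) ^ 2 := pow_le_pow_left₀ (by linarith only [hxn2]) h1 2
    have h3 : (l * ρ) ^ 2 = 3 * t * ρ ^ 2 := by rw [mul_pow, hl2]
    rw [h3] at h2
    linarith only [h2]
  have hexp1 : hW (3 / 2) ^ (-(2 * (1 / 256 * ρ ^ 2))) ≤ Real.exp (-(κ * L * xn ^ 2 / (6 * t))) := by
    rw [Real.rpow_def_of_pos hh32, ← hL, Real.exp_le_exp, ← hκ]
    have : κ * L * xn ^ 2 / (6 * t) ≤ L * (2 * (κ * ρ ^ 2)) := by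
      rw [div_le_iff₀ (by positivity)]
      have h1 := mul_le_mul_of_nonneg_left hρx (mul_pos hκ0 hL0).le
      have h2 : κ * L * (12 * t * ρ ^ 2) = L * (2 * (κ * ρ ^ 2)) * (6 * t) := by ring
      linarith only [h1, h2]
    linarith only [this]
  have hexp2 : Real.exp (8 * A * ‖x‖ ^ 2) * Real.exp (-(κ * L * xn ^ 2 / (6 * t))) ≤
      Real.exp (8 * A * (‖x‖ ^ 2 - xn ^ 2)) * Real.exp (-(κ * L * xn ^ 2 / (12 * t))) := by
    rw [← Real.exp_add, ← Real.exp_add, Real.exp_le_exp]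
    have h1 : 8 * A * xn ^ 2 ≤ κ * L * xn ^ 2 / (12 * t) := by
      rw [le_div_iff₀ (by positivity)]
      have ht1' : t ≤ 1 := by linarith only [ht1]
      have h8 : 8 * A ≤ κ * L / 12 := by
        have h' : A ≤ κ * L / 96 := hA₀ ▸ hAA₀
        linarith only [h']
      have h9 : 8 * A * (12 * t) ≤ κ * L := by
        have h10 := mul_le_mul_of_nonneg_right h8 (by positivity : (0 : ℝ) ≤ 12 * t)
        have h11 : κ * L / 12 * (12 * t) = κ * L * t := by ring
        have h12 : κ * L * t ≤ κ * L * 1 := mul_le_mul_of_nonneg_left ht1' (mul_pos hκ0 hL0).le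
        linarith only [h10, h11, h12]
      have := mul_le_mul_of_nonneg_right h9 (sq_nonneg xn)
      linarith only [this]
    have h2 : κ * L * xn ^ 2 / (6 * t) = 2 * (κ * L * xn ^ 2 / (12 * t)) := by
      field_simp; ring
    rw [h2]
    linarith only [h1]
  -- ### the final bound
  set R : ℝ := Real.sqrt Cfin * Real.exp (4 * A * (‖x‖ ^ 2 - xn ^ 2)) *
    Real.exp (-(κ * L / 24 * xn ^ 2 / t)) with hR
  have hR0 : 0 ≤ R := by positivity
  have hR2 : R ^ 2 = Cfin * (Real.exp (8 * A * (‖x‖ ^ 2 - xn ^ 2)) *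
      Real.exp (-(κ * L * xn ^ 2 / (12 * t)))) := by
    have e1 : Real.exp (4 * A * (‖x‖ ^ 2 - xn ^ 2)) ^ 2 = Real.exp (8 * A * (‖x‖ ^ 2 - xn ^ 2)) := by
      rw [← Real.exp_nat_mul]; congr 1; push_cast; ring
    have e2 : Real.exp (-(κ * L / 24 * xn ^ 2 / t)) ^ 2 = Real.exp (-(κ * L * xn ^ 2 / (12 * t))) := by
      rw [← Real.exp_nat_mul]; congr 1; push_cast; field_simp; ring
    rw [hR, mul_pow, mul_pow, Real.sq_sqrt hCfin0.le, e1, e2, mul_assoc]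
  have hsq : ‖u (t, x)‖ ^ 2 ≤ R ^ 2 := by
    rw [hR2]
    calc ‖u (t, x)‖ ^ 2 ≤ Cfin * Real.exp (8 * A * ‖x‖ ^ 2) * hW (3 / 2) ^ (-(2 * (1 / 256 * ρ ^ 2))) :=
          hmainsq
      _ ≤ Cfin * (Real.exp (8 * A * ‖x‖ ^ 2) * Real.exp (-(κ * L * xn ^ 2 / (6 * t)))) := by
          rw [mul_assoc]
          exact mul_le_mul_of_nonneg_left (mul_le_mul_of_nonneg_left hexp1 (Real.exp_pos _).le)
            hCfin0.le
      _ ≤ _ := mul_le_mul_of_nonneg_left hexp2 hCfin0.le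
  have hfin : ‖u (t, x)‖ ≤ R := (pow_le_pow_iff_left₀ (norm_nonneg _) hR0 two_ne_zero).1 hsq
  refine hfin.trans ?_
  rw [hR]
  have hfac : 0 ≤ Real.exp (4 * A * (‖x‖ ^ 2 - xn ^ 2)) * Real.exp (-(κ * L / 24 * xn ^ 2 / t)) := by
    positivity
  have := mul_le_mul_of_nonneg_right (by linarith only : Real.sqrt Cfin ≤ Real.sqrt Cfin + 1) hfac
  linarith only [this, mul_assoc (Real.sqrt Cfin) (Real.exp (4 * A * (‖x‖ ^ 2 - xn ^ 2)))
    (Real.exp (-(κ * L / 24 * xn ^ 2 / t))), mul_assoc (Real.sqrt Cfin + 1)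
    (Real.exp (4 * A * (‖x‖ ^ 2 - xn ^ 2))) (Real.exp (-(κ * L / 24 * xn ^ 2 / t)))]

end Decay

end Carleman

end Literature.Analysis.FluidPDE
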